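import Summits.BirchSwinnertonDyer.BirchSwinnertonDyer.Theorems.QuadraticBranchSignedControlPlusEtaNonsurjPlusCoeffCongruence
import Summits.BirchSwinnertonDyer.BirchSwinnertonDyer.Theorems.QuadraticBranchSignedControlPlusEtaNonsurjMinusCoeffCongruenceMazur
import Summits.BirchSwinnertonDyer.BirchSwinnertonDyer.Theorems.QuadraticBranchSignedControlPlusEtaNonsurjPrimeLFunctionShape
import HarnessLib

/-!
# Route `QuadraticBranchSignedControl` (rung K8, cell `bsd-potss`), residual crux `PlusEtaMainConjectureNonsurj`
# (stmt-BirchSwinnertonDyer-19606): THE θ-COEFFICIENT CONGRUENCE, PLUS SIDE, READINGS — the records' hypothesis `hX`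
# «`(L_p⁺(V,η,X)) = (X)`» PRODUCED from `L(W,1) = 0` (analytic rank one) and ONE displayed rational valuation `v_p(ϖ·coeff₁θ₂(η)) = 1`
# (seat `bsd-potss-k8eta-c2` g24; sequel of `…PlusCoeffCongruence.lean`)

WHY. Every rank-one `BSD_p` record of this crux (g20–g24, doors L2/L4/L6/L6⁻) displays
`hX : ∀ f ϖ Lη, IsNewformOf V f → (period relation) → IsQuadraticBranchPlusLFunction f p ϖ Lη → (Lη) = (X)` — the input of the
`η`-main-conjecture-to-`BSD_p` chain, so far MEASURED by PARI's `ellpadiclambdamu` (`λ⁺ = 1, μ⁺ = 0`). `(Lη) = (X)` says `Lη(0) = 0` and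
`coeff₁ Lη ∈ ℤ_pˣ`. (i) `Lη(0) = 0` is a TREE THEOREM from `r_an(W) ≠ 0` (EtaPrimeRoad's
`constantCoeff_eq_zero_of_analyticRank_ne_zero`, `…PrimeLFunctionShape.lean`: Kobayashi (3.6) + Birch for the `p*`-twist, `hmod`), and EtaPrimeRoad's
`span_eq_span_X_of_analyticRank_ne_zero_of_isUnit_coeff_one` already reduces `hX` to the displayed unit binder (ii) `coeff₁ Lη ∈ ℤ_pˣ` — which THIS
FILE produces from the plus θ-coefficient congruence at level `2` (`coeff₁θ₂(η) = p·coeff₁M⁺ + (coeff₁ω⁻₂)·M⁺(0) + p²r`, `M⁺(0) = 0`, `Lη = v·ϖ·M⁺`) and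
the displayed valuation `v_p(ϖ·coeff₁θ₂(η)) = 1` of ONE rational — a signed sum of `p²(p−1)` modular symbols `[a/p³]^δ` weighted by `s`
(`‖ϖ‖_p ≤ 1` from Mazur's `hM`). With the minus files, NO `p`-adic `L`-function numerics remain in a rank-one record: the analytic inputs are two
symbol valuations (`θ₂`: `= 1`; `θ₃`: `= 2` on the `λ⁻ = 3` rows / `θ₁`: `= 0` on the `λ⁻ = 1` rows).

WHAT. §5 `isUnit_coeff_one_plus_of_padicValRat` (level `2` reading: `L(0) = 0 ∧ v_p(ϖ·coeff₁θ₂(η)) = 1 ⟹ coeff₁ L ∈ ℤ_pˣ`); §7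
`isUnit_coeff_one_plus_of_mazurTate_padicValRat` = VERBATIM EtaPrimeRoad's displayed binder `hcoef` «`coeff₁ Lη ∈ ℤ_pˣ`»
(`…PrimeLFunctionShape.lean`, so far PARI `λ⁺ = 1, μ⁺ = 0`) PRODUCED from `hmod`, `hM`, `r_an(W) ≠ 0` and the displayed
`v_p(ϖ·coeff₁θ₂(η)) = 1`; `span_eq_span_X_of_mazurTate_padicValRat` = VERBATIM the records' `hX` (EtaPrimeRoad's
`span_eq_span_X_of_analyticRank_ne_zero_of_isUnit_coeff_one` ∘ §7).

HONEST FRAMING (cell `bsd-potss`; FULL-BSD rank ≤ 1 programme, HUMAN RULING D-0036/D-0074): TOOL THEOREMS ONLY — no definition, no named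
fact minted, no `sorry`, axioms standard; CONDITIONAL on the displayed named facts `hmod` (modularity) and `hM` (Mazur); the symbol valuation
stays a DISPLAYED per-row numerical hypothesis; nothing about (A), (C1⁺_η), C-cc-1 or `BSD(W,p)` of any pair is claimed; no stub of 19606 is proved;
crux and route OPEN; nothing booked. `--supports stmt-BirchSwinnertonDyer-19606`.

References: [Kobayashi2003] Thm. 3.2, (3.4), (3.6) (p. 7); [Pollack2003] Prop. 6.18; [MazurTateTeitelbaum1986Invent] §I.8 (8.6), §I.13;
[Pal2012] Thm. 3.2; [Mazur1978] Cor. 4.1; [GrossZagier1986] I (6.1) (order of vanishing).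
-/

set_option autoImplicit false
set_option linter.dupNamespace false
noncomputable section

open scoped Classical MatrixGroups ModularForm nonZeroDivisors

open CongruenceSubgroup Polynomial WeierstrassCurve Literature.NumberTheory.EllipticCurves
  Literature.NumberTheory.EllipticCurves.ModularForms
  Literature.NumberTheory.EllipticCurves.Rank1Residual
open Summit.BirchSwinnertonDyer.Rank1Residual Summit.BirchSwinnertonDyer.Rank1Residual.Additive
open Summit.BirchSwinnertonDyer.BirchSwinnertonDyer.Theorems.EtaMinusCoeffCongruence

namespace Summit.BirchSwinnertonDyer.BirchSwinnertonDyer.Theorems.EtaPlusCoeffCongruence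

/-! ## §5 Level `2`: `coeff₁ L_p⁺(V,η,X) ∈ ℤ_pˣ` from `v_p(ϖ·coeff₁θ₂(η)) = 1` when `L_p⁺(V,η,0) = 0` -/

section LevelTwo

variable {p : ℕ} [hp : Fact p.Prime] {N : ℕ} [NeZero N] {f : CuspForm (Gamma0 N) 2}

/-- **Level `2` reading: the `X`-coefficient of `L_p⁺(V,η,X)` is a UNIT** when `L(0) = 0` and the displayed rational `ϖ·coeff₁θ₂(η)`
(`θ₂(η) = quadraticBranchMazurTateElement p f 2`, a signed sum of `p²(p−1)` modular symbols) has `p`-adic valuation exactly `1`: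
`L = v·ϖ·M⁺`, `M⁺(0) = 0` (as `ϖ ≠ 0`), `coeff₁θ₂(η) = p·coeff₁M⁺ + p²r` (§3 of the prequel at `m = 1`), and `‖p²ϖr‖ ≤ p^{−2} < p^{−1}`.
[cite: Pollack2003, Prop. 6.18] [cite: Kobayashi2003, Thm. 3.2, (3.4), (3.6) (p. 7)] -/
theorem isUnit_coeff_one_plus_of_padicValRat (hp2 : p ≠ 2) (hf0 : IsNewform0 f) (hQ : coeffField f = ⊥)
    (hpN : ¬ p ∣ N) (hap : cuspCoeff f p = ((0 : ℤ) : ℂ)) {ϖ : ℚ} (hϖ : ‖(ϖ : ℚ_[p])‖ ≤ 1)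
    {L : IwasawaAlgebra p} (hL : IsQuadraticBranchPlusLFunction f p ϖ L) (hL0 : PowerSeries.constantCoeff L = 0)
    (hθ0 : ϖ * (quadraticBranchMazurTateElement p f (2 * 1)).coeff 1 ≠ 0)
    (hθ : padicValRat p (ϖ * (quadraticBranchMazurTateElement p f (2 * 1)).coeff 1) = 1) :
    IsUnit (PowerSeries.coeff 1 L) := by
  have hP : p.Prime := hp.out
  have hp1 : (1 : ℝ) < p := by exact_mod_cast hP.one_lt
  have hp0 : (0 : ℝ) < p := by positivity
  obtain ⟨M, hM⟩ := exists_isCongrModOmega_quadraticBranch_even hp2 hf0 hQ hpN hap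
  obtain ⟨v, hv⟩ := exists_units_forall_coeff_eq_plus hp2 hϖ hL hM
  -- `M⁺(0) = 0`: `L(0) = v ϖ M⁺(0)`, `ϖ ≠ 0`
  have hϖ0 : (ϖ : ℚ_[p]) ≠ 0 := by
    have h : ϖ ≠ 0 := fun h0 ↦ hθ0 (by rw [h0, zero_mul])
    exact_mod_cast h
  have hM0 : ((PowerSeries.constantCoeff M : ℤ_[p]) : ℚ_[p]) = 0 := by
    have h := hv 0
    rw [PowerSeries.coeff_zero_eq_constantCoeff_apply, PowerSeries.coeff_zero_eq_constantCoeff_apply, hL0,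
      PadicInt.coe_zero] at h
    have h' := h.symm
    rw [mul_eq_zero, mul_eq_zero] at h'
    rcases h' with h' | h' | h'
    · exact absurd h' (PadicInt.coe_ne_zero.mpr (Units.ne_zero v))
    · exact absurd h' hϖ0
    · exact h'
  -- the level-`2` identity: `θ₂,₁ = p M₁ + p² r`
  obtain ⟨r, hr⟩ := exists_coeff_one_mazurTate_plus_eq hp2 hf0 hQ hpN hap 1 (hM 1)
  rw [hM0, mul_zero, add_zero, show ((-1 : ℚ_[p]) ^ (1 + 1)) = 1 by norm_num, one_mul, pow_one] at hr
  -- norms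
  set c : ℚ_[p] := ((PowerSeries.coeff 1 L : ℤ_[p]) : ℚ_[p]) with hc
  set x : ℚ_[p] := (ϖ : ℚ_[p]) * (((quadraticBranchMazurTateElement p f (2 * 1)).coeff 1 : ℚ) : ℚ_[p]) with hx
  have hnx : ‖x‖ = (p : ℝ)⁻¹ := by
    rw [hx, ← Rat.cast_mul, Padic.eq_padicNorm, padicNorm.eq_zpow_of_nonzero hθ0, hθ]
    push_cast
    rw [zpow_neg, zpow_one]
  have hB : ‖(p : ℚ_[p]) ^ (2 * 1) * ((ϖ : ℚ_[p]) * (r : ℚ_[p]))‖ < (p : ℝ)⁻¹ := by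
    have h1 : ‖(p : ℚ_[p]) ^ (2 * 1) * ((ϖ : ℚ_[p]) * (r : ℚ_[p]))‖ ≤ ((p : ℝ)⁻¹) ^ 2 := by
      rw [norm_mul, norm_mul, norm_pow, Padic.norm_p, PadicInt.padic_norm_e_of_padicInt, show 2 * 1 = 2 from rfl]
      calc ((p : ℝ)⁻¹) ^ 2 * (‖(ϖ : ℚ_[p])‖ * ‖r‖) ≤ ((p : ℝ)⁻¹) ^ 2 * (1 * 1) := by
            gcongr
            exact PadicInt.norm_le_one r
        _ = ((p : ℝ)⁻¹) ^ 2 := by ring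
    refine h1.trans_lt ?_
    have hlt : (p : ℝ)⁻¹ < 1 := inv_lt_one_of_one_lt₀ hp1
    have hpos : (0 : ℝ) < (p : ℝ)⁻¹ := inv_pos.mpr hp0
    nlinarith
  -- `p · (ϖ M₁) = x − p² ϖ r`
  have hkey : (p : ℚ_[p]) * ((ϖ : ℚ_[p]) * ((PowerSeries.coeff 1 M : ℤ_[p]) : ℚ_[p])) =
      x + -((p : ℚ_[p]) ^ (2 * 1) * ((ϖ : ℚ_[p]) * (r : ℚ_[p]))) := by
    rw [hx, hr]
    ring
  have hB' : ‖-((p : ℚ_[p]) ^ (2 * 1) * ((ϖ : ℚ_[p]) * (r : ℚ_[p])))‖ < ‖x‖ := by rwa [norm_neg, hnx]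
  have hn1 : ‖(p : ℚ_[p]) * ((ϖ : ℚ_[p]) * ((PowerSeries.coeff 1 M : ℤ_[p]) : ℚ_[p]))‖ = (p : ℝ)⁻¹ := by
    rw [hkey, Padic.add_eq_max_of_ne hB'.ne', max_eq_left hB'.le, hnx]
  rw [norm_mul, Padic.norm_p] at hn1
  have hn2 : ‖(ϖ : ℚ_[p]) * ((PowerSeries.coeff 1 M : ℤ_[p]) : ℚ_[p])‖ = 1 := by
    have hpm : (p : ℝ)⁻¹ ≠ 0 := inv_ne_zero hp0.ne'
    field_simp at hn1
    linarith [hn1]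
  have hnc : ‖c‖ = 1 := by
    rw [hc, hv 1, norm_mul, PadicInt.padic_norm_e_of_padicInt, PadicInt.norm_units, one_mul, hn2]
  exact PadicInt.isUnit_iff.mpr hnc

end LevelTwo

/-! ## §7 The record-facing forms: `IsUnit (coeff₁ L_p⁺)` and `hX` PRODUCED from `r_an(W) ≠ 0`, `hmod`, `hM` and ONE symbol valuation -/

section Records

variable (p : ℕ) [hp : Fact p.Prime]

/-- **`coeff₁ L_p⁺(V,η,X) ∈ ℤ_pˣ` FROM SYMBOLS** — verbatim the displayed binder `hcoef` of EtaPrimeRoad's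
`span_eq_span_X_of_analyticRank_ne_zero_of_isUnit_coeff_one` (so far PARI's `λ⁺ = 1, μ⁺ = 0`), PRODUCED: `W` globally minimal with
`r_an(W) ≠ 0`, `p ≥ 5`, `V = C • W^{(p*)}` a good `a_p = 0` globally minimal twin, named facts `hmod` (modularity: `L_p⁺(V,η,0) = 0` by
EtaPrimeRoad's `constantCoeff_eq_zero_of_analyticRank_ne_zero`) and `hM` (Mazur: `‖ϖ‖_p ≤ 1`); DISPLAYED: for the newform `f` of `V` and every
period ratio `ϖ`, `ϖ · coeff₁(quadraticBranchMazurTateElement p f 2)` is a non-zero rational of `p`-adic valuation `1`.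
[cite: Kobayashi2003, Thm. 3.2, (3.4), (3.6) (p. 7)] [cite: Pollack2003, Prop. 6.18] [cite: Mazur1978, Cor. 4.1] -/
theorem isUnit_coeff_one_plus_of_mazurTate_padicValRat (hmod : hasEntireLFunction_rat)
    (hM : mazur_not_dvd_maninConstant_of_odd) (hp5 : 5 ≤ p) (W : WeierstrassCurve ℚ) [W.IsElliptic] [W.IsGloballyMinimal]
    (hr : W.analyticRank ≠ 0) (V : WeierstrassCurve ℚ) [V.IsElliptic] [V.IsGloballyMinimal] (C : VariableChange ℚ)
    (hCV : C • W.quadraticTwist ((-1) ^ (p / 2) * p) = V) (hgood : V.HasGoodReductionAtPrime p)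
    (hap : V.frobeniusTrace p = 0)
    (hθ : ∀ {N : ℕ} [NeZero N] {f : CuspForm (Gamma0 N) 2}, IsNewformOf V f →
      ∀ (ϖ : ℚ), (if Even (p / 2) then (ϖ : ℝ) * V.realPeriodRat = plusPeriod f
          else (ϖ : ℝ) * V.imaginaryPeriodRat = minusPeriod f) →
        ϖ * (quadraticBranchMazurTateElement p f 2).coeff 1 ≠ 0 ∧
          padicValRat p (ϖ * (quadraticBranchMazurTateElement p f 2).coeff 1) = 1) :
    ∀ {N : ℕ} [NeZero N] {f : CuspForm (Gamma0 N) 2}, IsNewformOf V f →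
      ∀ (ϖ : ℚ), (if Even (p / 2) then (ϖ : ℝ) * V.realPeriodRat = plusPeriod f
          else (ϖ : ℝ) * V.imaginaryPeriodRat = minusPeriod f) →
      ∀ (Lη : IwasawaAlgebra p), IsQuadraticBranchPlusLFunction f p ϖ Lη → IsUnit (PowerSeries.coeff 1 Lη) := by
  intro N _ f hf ϖ hrel Lη hL
  have hp2 : p ≠ 2 := by omega
  have hϖ := norm_periodRatio_le_one_of_mazur p hM hp5 V f hf hgood hap ϖ hrel
  have hL0 := EtaPrimeRoad.constantCoeff_eq_zero_of_analyticRank_ne_zero p hmod hp2 W V C hCV hgood hf hrel hL hr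
  obtain ⟨hθ0, hθv⟩ := hθ hf ϖ hrel
  have hap' : cuspCoeff f p = ((0 : ℤ) : ℂ) := by
    rw [cuspCoeff_eq_frobeniusTrace_of_isNewformOf_holds hf hgood, hap]
  exact isUnit_coeff_one_plus_of_padicValRat hp2 hf.1 hf.coeffField_eq_bot (not_dvd_level_of_isNewformOf hf hgood)
    hap' hϖ hL hL0 hθ0 hθv

/-- **`hX` FROM SYMBOLS.** Same data, `r_an(W) = 1`: verbatim the hypothesis `hX` of the rank-one records — for every plus branch function
`Lη` of the newform of `V`, `(Lη) = (X)` in `Λ` (EtaPrimeRoad's `span_eq_span_X_of_analyticRank_ne_zero_of_isUnit_coeff_one` ∘ the symbol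
reading above). [cite: Kobayashi2003, Thm. 3.2, (3.4), (3.6) (p. 7)] [cite: Pollack2003, Prop. 6.18] [cite: Mazur1978, Cor. 4.1] -/
theorem span_eq_span_X_of_mazurTate_padicValRat (hmod : hasEntireLFunction_rat) (hM : mazur_not_dvd_maninConstant_of_odd)
    (hp5 : 5 ≤ p) (W : WeierstrassCurve ℚ) [W.IsElliptic] [W.IsGloballyMinimal] (hr : W.analyticRank = 1)
    (V : WeierstrassCurve ℚ) [V.IsElliptic] [V.IsGloballyMinimal] (C : VariableChange ℚ)
    (hCV : C • W.quadraticTwist ((-1) ^ (p / 2) * p) = V) (hgood : V.HasGoodReductionAtPrime p)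
    (hap : V.frobeniusTrace p = 0)
    (hθ : ∀ {N : ℕ} [NeZero N] {f : CuspForm (Gamma0 N) 2}, IsNewformOf V f →
      ∀ (ϖ : ℚ), (if Even (p / 2) then (ϖ : ℝ) * V.realPeriodRat = plusPeriod f
          else (ϖ : ℝ) * V.imaginaryPeriodRat = minusPeriod f) →
        ϖ * (quadraticBranchMazurTateElement p f 2).coeff 1 ≠ 0 ∧
          padicValRat p (ϖ * (quadraticBranchMazurTateElement p f 2).coeff 1) = 1) :
    ∀ {N : ℕ} [NeZero N] {f : CuspForm (Gamma0 N) 2}, IsNewformOf V f →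
      ∀ (ϖ : ℚ), (if Even (p / 2) then (ϖ : ℝ) * V.realPeriodRat = plusPeriod f
          else (ϖ : ℝ) * V.imaginaryPeriodRat = minusPeriod f) →
      ∀ (Lη : IwasawaAlgebra p), IsQuadraticBranchPlusLFunction f p ϖ Lη →
        Ideal.span {Lη} = Ideal.span {(PowerSeries.X : IwasawaAlgebra p)} := by
  intro N _ f hf ϖ hrel Lη hL
  have hr' : W.analyticRank ≠ 0 := by rw [hr]; exact Nat.one_ne_zero
  exact EtaPrimeRoad.span_eq_span_X_of_analyticRank_ne_zero_of_isUnit_coeff_one hmod V W C p hp5 hCV hgood hr'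
    (isUnit_coeff_one_plus_of_mazurTate_padicValRat p hmod hM hp5 W hr' V C hCV hgood hap hθ) hf ϖ hrel Lη hL

end Records

end Summit.BirchSwinnertonDyer.BirchSwinnertonDyer.Theorems.EtaPlusCoeffCongruence

end
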